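import Literature.InformationTheory.QuantumCodes.TwoBlockTannerGraph
import HarnessLib

/-!
# Covering graphs of Tanner graphs (Symons–Rajput–Browne 2025): the definition of an `h`-cover code and
# the theorem that an algebraic cover of an abelian two-block code IS a Tanner-graph cover

B. C. B. Symons, A. Rajput, D. E. Browne, *Sequences of Bivariate Bicycle Codes from Covering Graphs*,
arXiv:2511.13560v3 (2026) = PRX Quantum (2026) [SymonsRajputBrowne2025] (held text
`paper:arxiv-2511.13560`, chunks pNNNN), read on the page:

> **Definition 3 (Covering Graph).** A covering graph or a lift of a graph `G(V,E)` is a graph `C(Ṽ,Ẽ)`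
> with a surjective covering map `p : Ṽ → V` … such that for each `ṽ ∈ Ṽ`, `p` restricted to the
> neighbourhood `N(ṽ)` is a bijection between `N(ṽ)` and `N(p(ṽ))`. … If `p` is such that `p⁻¹(v)` has
> cardinality `n` for all `v ∈ V`, then `C(Ṽ,Ẽ)` is an `n`-sheeted cover. (chunk p0005 L32–35)
>
> "We refer to these codes as `h`-cover codes when their Tanner graph `T(Q̃)` is a `h`-fold covering graph
> of `T(Q)`." (chunk p0003 L41–42)
>
> **Theorem 3.1 / 3.3.** For BB codes `Q(A,B,l,m)`, `Q̃(Ã,B̃,l̃,m̃)` with `l̃ = ul`, `m̃ = tm` and the exponents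
> of the monomials of `Ã` (resp. `B̃`) reducing `mod (l,m)` to those of `A` (resp. `B`) term by term,
> "the Tanner graph `T̃` equipped with the natural projection map is a `|Γ| = ut`-fold covering graph of `T`"
> (chunk p0013 L23–L40, p0016 L13–17).

This file types Definition 3 for Mathlib `SimpleGraph`s and PROVES Theorem 3.3 in the natural
generality of the tree's abelian two-block codes (`AbelianTwoBlock.css a b`, any finite abelian group;
the BB case is `G = ℤ_ℓ × ℤ_m` and the reduction homomorphism `ℤ_{ul} × ℤ_{tm} → ℤ_l × ℤ_m`):

* `IsGraphCovering C B p` (Def. 3), `IsSheetedCovering C B p n` (`n`-sheeted), and for CSS codes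
  `CSSCode.IsTannerCover C̃ C h` := "the Tanner graph of `C̃` is an `h`-fold covering graph of that of `C`"
  (the printed "`h`-cover code" relation; `CSSCode.tannerGraph`, `TannerGraph.lean`);
* `AbelianTwoBlock.IsAlgCover φ ã b̃ a b` — the algebraic cover condition of Thm 3.1 for a surjective
  homomorphism `φ : G̃ →+ G`: `φ` maps `supp ã` bijectively onto `supp a` and `supp b̃` onto `supp b`
  (conditions 3–4: the monomials reduce term by term, none colliding; conditions 1–2 are `φ` itself);
* **`AbelianTwoBlock.isSheetedCovering_of_isAlgCover`** (Thm 3.3): then the type-preserving projection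
  `coverMap φ` (`X ĩ ↦ X (φ ĩ)`, `Z`, `L`, `R` likewise) is a `|ker φ|`-sheeted covering map
  `T(css ã b̃) → T(css a b)`; hence **`AbelianTwoBlock.isTannerCover_of_isAlgCover`**: `css ã b̃` is a
  `|ker φ|`-cover code of `css a b`.

Not here: the paper's parameter theorems (Thm 4.6 `k_h ≥ k`, Thm 4.7 `h` odd ⇒ `d_h ≤ hd`) — in the
tree Summits-side in the surjective-pushforward form (qec census `TwoBlockQuotientMaps.lean`); and
CONJECTURE 1 (chunk p0026 L7: "All `h`-cover BB codes obey `d ≤ d_h ≤ hd`") — a conjecture is not a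
Literature statement; it is filed Summits-side against `CSSCode.IsTannerCover`. No named facts, no instances.

## References (locators read on the page)
* [SymonsRajputBrowne2025] arXiv:2511.13560v3: Def. 3 (chunk p0005 L32–35), "h-cover codes" (p0003
  L41–42), Thm 3.1 (p0013 L23–40, p0014 L1–14), Thm 3.3 (p0016 L13–17), Conjecture 1 (p0026 L7).
* [BravyiEtAl2024] arXiv:2308.07915 §2, §5 (Tanner graph of `QC(A,B)`; tree `TannerGraph.lean`,
  `TwoBlockTannerGraph.lean`).
-/

namespace Literature.InformationTheory.QuantumCodes

open SimpleGraph

/-! ### Covering maps of simple graphs (Definition 3) -/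

section GraphCover

variable {V W : Type*}

/-- **Covering graph / covering map** (Symons–Rajput–Browne Def. 3): `p : Ṽ → V` from the cover `C` to
the base `B` is surjective and maps the neighbourhood of every vertex `ṽ` bijectively onto the
neighbourhood of `p ṽ`. [cite: SymonsRajputBrowne2025, Def. 3 (arXiv:2511.13560v3 chunk p0005 L32–35)] -/
def IsGraphCovering (C : SimpleGraph W) (B : SimpleGraph V) (p : W → V) : Prop :=
  Function.Surjective p ∧ ∀ w : W, Set.BijOn p (C.neighborSet w) (B.neighborSet (p w))

/-- An **`n`-sheeted cover**: a covering map all of whose fibres have exactly `n` elements.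
[cite: SymonsRajputBrowne2025, Def. 3 (arXiv:2511.13560v3 chunk p0005 L34–35: "If p is such that p⁻¹(v) has cardinality n for all v ∈ V, then C is an n-sheeted cover")] -/
def IsSheetedCovering (C : SimpleGraph W) (B : SimpleGraph V) (p : W → V) (n : ℕ) : Prop :=
  IsGraphCovering C B p ∧ ∀ v : V, Nat.card {w : W // p w = v} = n

/-- A covering map preserves adjacency. [cite: SymonsRajputBrowne2025, Def. 3 (arXiv:2511.13560v3 chunk p0005 L32–35)] -/
theorem IsGraphCovering.map_adj {C : SimpleGraph W} {B : SimpleGraph V} {p : W → V} (h : IsGraphCovering C B p)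
    {w w' : W} (hww' : C.Adj w w') : B.Adj (p w) (p w') :=
  (h.2 w).mapsTo hww'

end GraphCover

namespace CSSCode

variable {RX RZ Q RX' RZ' Q' : Type*} [Fintype Q] [Fintype Q']

/-- **`C̃` is an `h`-cover code of `C`**: the Tanner graph of `C̃` is an `h`-fold (`h`-sheeted) covering
graph of the Tanner graph of `C`. [cite: SymonsRajputBrowne2025, §1 (arXiv:2511.13560v3 chunk p0003 L41–42: "We refer to these codes as h-cover codes when their Tanner graph T(Q̃) is a h-fold covering graph of T(Q)")] -/
def IsTannerCover (C' : CSSCode RX' RZ' Q') (C : CSSCode RX RZ Q) (h : ℕ) : Prop :=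
  ∃ p : (RX' ⊕ RZ') ⊕ Q' → (RX ⊕ RZ) ⊕ Q, IsSheetedCovering C'.tannerGraph C.tannerGraph p h

end CSSCode

/-! ### Algebraic covers of abelian two-block codes are Tanner-graph covers (Theorems 3.1 / 3.3) -/

namespace AbelianTwoBlock

variable {G G' : Type*} [AddCommGroup G] [AddCommGroup G'] [Fintype G] [Fintype G']

/-- **The algebraic cover condition** (SRB Thm 3.1, conditions 1–4, for abelian two-block codes): a
surjective homomorphism `φ : G̃ → G` of the index groups (`ℤ_{ul} × ℤ_{tm} → ℤ_l × ℤ_m`, reduction of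
exponents) under which the monomials of `ã` reduce to those of `a` term by term with no two colliding —
i.e. `φ` maps `supp ã` bijectively onto `supp a` — and likewise `b̃ ↦ b`.
[cite: SymonsRajputBrowne2025, Thm 3.1 conditions 1–4 (arXiv:2511.13560v3 chunk p0013 L31–40)] -/
def IsAlgCover (φ : G' →+ G) (a' b' : G' → ZMod 2) (a b : G → ZMod 2) : Prop :=
  Function.Surjective φ ∧ Set.BijOn φ {g | a' g ≠ 0} {g | a g ≠ 0} ∧ Set.BijOn φ {g | b' g ≠ 0} {g | b g ≠ 0}

/-- **The natural projection of Tanner-graph vertices** along `φ`: `X ĩ ↦ X (φ ĩ)`, `Z ĩ ↦ Z (φ ĩ)`,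
`L j̃ ↦ L (φ j̃)`, `R j̃ ↦ R (φ j̃)` ("the natural map `c : V′ → V` sending `(v, g) ↦ v`").
[cite: SymonsRajputBrowne2025, Thm 3.3 (arXiv:2511.13560v3 chunk p0016 L13–17)] -/
def coverMap (φ : G' →+ G) : (G' ⊕ G') ⊕ (G' ⊕ G') → (G ⊕ G) ⊕ (G ⊕ G) :=
  Sum.map (Sum.map φ φ) (Sum.map φ φ)

omit [Fintype G] [Fintype G'] in
/-- `coverMap φ (X i) = X (φ i)`. [cite: SymonsRajputBrowne2025, Thm 3.3 (arXiv:2511.13560v3 chunk p0016 L13–17)] -/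
@[simp] theorem coverMap_vX (φ : G' →+ G) (i : G') : coverMap φ (vX i) = vX (φ i) := rfl

omit [Fintype G] [Fintype G'] in
/-- `coverMap φ (Z i) = Z (φ i)`. [cite: SymonsRajputBrowne2025, Thm 3.3 (arXiv:2511.13560v3 chunk p0016 L13–17)] -/
@[simp] theorem coverMap_vZ (φ : G' →+ G) (i : G') : coverMap φ (vZ i) = vZ (φ i) := rfl

omit [Fintype G] [Fintype G'] in
/-- `coverMap φ (L j) = L (φ j)`. [cite: SymonsRajputBrowne2025, Thm 3.3 (arXiv:2511.13560v3 chunk p0016 L13–17)] -/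
@[simp] theorem coverMap_vL (φ : G' →+ G) (j : G') : coverMap φ (vL j) = vL (φ j) := rfl

omit [Fintype G] [Fintype G'] in
/-- `coverMap φ (R j) = R (φ j)`. [cite: SymonsRajputBrowne2025, Thm 3.3 (arXiv:2511.13560v3 chunk p0016 L13–17)] -/
@[simp] theorem coverMap_vR (φ : G' →+ G) (j : G') : coverMap φ (vR j) = vR (φ j) := rfl

omit [Fintype G] [Fintype G'] in
/-- The projection is surjective when `φ` is. [cite: SymonsRajputBrowne2025, Def. 3 / Thm 3.3 (arXiv:2511.13560v3 chunk p0005 L32–35, p0016 L13–17)] -/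
theorem coverMap_surjective (φ : G' →+ G) (hφ : Function.Surjective φ) : Function.Surjective (coverMap φ) := by
  rintro ((i | i) | (j | j))
  · obtain ⟨i', rfl⟩ := hφ i; exact ⟨vX i', rfl⟩
  · obtain ⟨i', rfl⟩ := hφ i; exact ⟨vZ i', rfl⟩
  · obtain ⟨j', rfl⟩ := hφ j; exact ⟨vL j', rfl⟩
  · obtain ⟨j', rfl⟩ := hφ j; exact ⟨vR j', rfl⟩

omit [Fintype G] [Fintype G'] in
/-- The fibre of a surjective homomorphism over any point has `|ker φ|` elements (a translate of the kernel).
[folklore] -/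
private theorem card_fiber_hom (φ : G' →+ G) (hφ : Function.Surjective φ) (g : G) :
    Nat.card {g' : G' // φ g' = g} = Nat.card φ.ker := by
  obtain ⟨g₀, hg₀⟩ := hφ g
  refine Nat.card_congr
    { toFun := fun x => ⟨x.1 - g₀, by rw [AddMonoidHom.mem_ker, map_sub, x.2, hg₀, sub_self]⟩
      invFun := fun y => ⟨y.1 + g₀, by
        have := (AddMonoidHom.mem_ker).1 y.2
        rw [map_add, this, hg₀, zero_add]⟩
      left_inv := fun x => by simp
      right_inv := fun y => by simp }

omit [Fintype G] [Fintype G'] in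
/-- The fibre of `coverMap φ` over a vertex of a given class is the `φ`-fibre inside that class. [folklore] -/
private theorem card_fiber_class (φ : G' →+ G) {v : (G ⊕ G) ⊕ (G ⊕ G)} {g : G}
    (mk' : G' → (G' ⊕ G') ⊕ (G' ⊕ G')) (hinj : Function.Injective mk')
    (hp : ∀ g', coverMap φ (mk' g') = v ↔ φ g' = g)
    (honly : ∀ w, coverMap φ w = v → ∃ g', w = mk' g') :
    Nat.card {w : (G' ⊕ G') ⊕ (G' ⊕ G') // coverMap φ w = v} = Nat.card {g' : G' // φ g' = g} := by
  symm
  refine Nat.card_congr (Equiv.ofBijective (fun x => ⟨mk' x.1, (hp x.1).2 x.2⟩) ⟨?_, ?_⟩)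
  · intro x y hxy
    exact Subtype.ext (hinj (congrArg Subtype.val hxy))
  · rintro ⟨w, hw⟩
    obtain ⟨g', rfl⟩ := honly w hw
    exact ⟨⟨g', (hp g').1 hw⟩, rfl⟩

omit [Fintype G] [Fintype G'] in
/-- **Every fibre of the projection has `|ker φ|` elements** (a coset of the kernel in the relevant vertex
class). [cite: SymonsRajputBrowne2025, Thm 3.3 (arXiv:2511.13560v3 chunk p0016 L13–17: "a |Γ| = ut-fold covering graph")] -/
theorem card_fiber_coverMap (φ : G' →+ G) (hφ : Function.Surjective φ) (v : (G ⊕ G) ⊕ (G ⊕ G)) :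
    Nat.card {w : (G' ⊕ G') ⊕ (G' ⊕ G') // coverMap φ w = v} = Nat.card φ.ker := by
  rcases v with (i | i) | (j | j)
  · rw [← card_fiber_hom φ hφ i]
    refine card_fiber_class φ vX (fun x y h => by simpa using h) (fun g' => by simp [coverMap]) ?_
    rintro ((i' | i') | (j' | j')) h <;> simp [coverMap] at h
    exact ⟨i', rfl⟩
  · rw [← card_fiber_hom φ hφ i]
    refine card_fiber_class φ vZ (fun x y h => by simpa using h) (fun g' => by simp [coverMap]) ?_
    rintro ((i' | i') | (j' | j')) h <;> simp [coverMap] at h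
    exact ⟨i', rfl⟩
  · rw [← card_fiber_hom φ hφ j]
    refine card_fiber_class φ vL (fun x y h => by simpa using h) (fun g' => by simp [coverMap]) ?_
    rintro ((i' | i') | (j' | j')) h <;> simp [coverMap] at h
    exact ⟨j', rfl⟩
  · rw [← card_fiber_hom φ hφ j]
    refine card_fiber_class φ vR (fun x y h => by simpa using h) (fun g' => by simp [coverMap]) ?_
    rintro ((i' | i') | (j' | j')) h <;> simp [coverMap] at h
    exact ⟨j', rfl⟩

/-- Neighbours of an `X`-check. [cite: BravyiEtAl2024, §5 (arXiv:2308.07915 chunk p0010 L47)] -/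
theorem adj_vX_iff (a b : G → ZMod 2) (i : G) (w : (G ⊕ G) ⊕ (G ⊕ G)) :
    (css a b).tannerGraph.Adj (vX i) w ↔ (∃ j, w = vL j ∧ a (i - j) ≠ 0) ∨ (∃ j, w = vR j ∧ b (i - j) ≠ 0) := by
  rcases w with (i' | i') | (j | j) <;> simp

/-- Neighbours of a `Z`-check. [cite: BravyiEtAl2024, §5 (arXiv:2308.07915 chunk p0010 L47)] -/
theorem adj_vZ_iff (a b : G → ZMod 2) (i : G) (w : (G ⊕ G) ⊕ (G ⊕ G)) :
    (css a b).tannerGraph.Adj (vZ i) w ↔ (∃ j, w = vL j ∧ b (j - i) ≠ 0) ∨ (∃ j, w = vR j ∧ a (j - i) ≠ 0) := by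
  rcases w with (i' | i') | (j | j) <;> simp

/-- Neighbours of a left qubit. [cite: BravyiEtAl2024, §5 (arXiv:2308.07915 chunk p0010 L47)] -/
theorem adj_vL_iff (a b : G → ZMod 2) (j : G) (w : (G ⊕ G) ⊕ (G ⊕ G)) :
    (css a b).tannerGraph.Adj (vL j) w ↔ (∃ i, w = vX i ∧ a (i - j) ≠ 0) ∨ (∃ i, w = vZ i ∧ b (j - i) ≠ 0) := by
  rcases w with (i | i) | (j' | j') <;> simp

/-- Neighbours of a right qubit. [cite: BravyiEtAl2024, §5 (arXiv:2308.07915 chunk p0010 L47)] -/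
theorem adj_vR_iff (a b : G → ZMod 2) (j : G) (w : (G ⊕ G) ⊕ (G ⊕ G)) :
    (css a b).tannerGraph.Adj (vR j) w ↔ (∃ i, w = vX i ∧ b (i - j) ≠ 0) ∨ (∃ i, w = vZ i ∧ a (j - i) ≠ 0) := by
  rcases w with (i | i) | (j' | j') <;> simp

omit [Fintype G] [Fintype G'] in
/-- The local bijection at a vertex whose neighbourhood consists of two labelled families
`{mk₁ j : j ∈ S₁} ∪ {mk₂ j : j ∈ S₂}`, mapped by `φ` onto the two families of the image vertex.
[cite: SymonsRajputBrowne2025, proof of Thm 3.1 / Lemma 3.2 (arXiv:2511.13560v3 chunk p0014 L15–31)] -/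
private theorem bijOn_two_families (φ : G' →+ G) {C : SimpleGraph ((G' ⊕ G') ⊕ (G' ⊕ G'))}
    {B : SimpleGraph ((G ⊕ G) ⊕ (G ⊕ G))} {w : (G' ⊕ G') ⊕ (G' ⊕ G')}
    (mk₁' mk₂' : G' → (G' ⊕ G') ⊕ (G' ⊕ G')) (mk₁ mk₂ : G → (G ⊕ G) ⊕ (G ⊕ G))
    (S₁ S₂ : Set G') (T₁ T₂ : Set G)
    (hC : ∀ x, C.Adj w x ↔ (∃ j, x = mk₁' j ∧ j ∈ S₁) ∨ (∃ j, x = mk₂' j ∧ j ∈ S₂))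
    (hB : ∀ y, B.Adj (coverMap φ w) y ↔ (∃ j, y = mk₁ j ∧ j ∈ T₁) ∨ (∃ j, y = mk₂ j ∧ j ∈ T₂))
    (hp₁ : ∀ j, coverMap φ (mk₁' j) = mk₁ (φ j)) (hp₂ : ∀ j, coverMap φ (mk₂' j) = mk₂ (φ j))
    (inj₁ : Function.Injective mk₁) (inj₂ : Function.Injective mk₂) (hne : ∀ j j', mk₁ j ≠ mk₂ j')
    (h₁ : Set.BijOn φ S₁ T₁) (h₂ : Set.BijOn φ S₂ T₂) :
    Set.BijOn (coverMap φ) (C.neighborSet w) (B.neighborSet (coverMap φ w)) := by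
  refine ⟨fun x hx => ?_, fun x₁ hx₁ x₂ hx₂ heq => ?_, fun y hy => ?_⟩
  · rw [mem_neighborSet, hC] at hx
    rw [mem_neighborSet, hB]
    rcases hx with ⟨j, rfl, hj⟩ | ⟨j, rfl, hj⟩
    · exact Or.inl ⟨φ j, hp₁ j, h₁.mapsTo hj⟩
    · exact Or.inr ⟨φ j, hp₂ j, h₂.mapsTo hj⟩
  · rw [mem_neighborSet, hC] at hx₁ hx₂
    rcases hx₁ with ⟨j₁, rfl, hj₁⟩ | ⟨j₁, rfl, hj₁⟩ <;> rcases hx₂ with ⟨j₂, rfl, hj₂⟩ | ⟨j₂, rfl, hj₂⟩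
    · rw [hp₁, hp₁] at heq; rw [h₁.injOn hj₁ hj₂ (inj₁ heq)]
    · rw [hp₁, hp₂] at heq; exact absurd heq (hne _ _)
    · rw [hp₂, hp₁] at heq; exact absurd heq.symm (hne _ _)
    · rw [hp₂, hp₂] at heq; rw [h₂.injOn hj₁ hj₂ (inj₂ heq)]
  · rw [mem_neighborSet, hB] at hy
    rcases hy with ⟨j, rfl, hj⟩ | ⟨j, rfl, hj⟩
    · obtain ⟨j', hj', rfl⟩ := h₁.surjOn hj
      exact ⟨mk₁' j', by rw [mem_neighborSet, hC]; exact Or.inl ⟨j', rfl, hj'⟩, hp₁ j'⟩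
    · obtain ⟨j', hj', rfl⟩ := h₂.surjOn hj
      exact ⟨mk₂' j', by rw [mem_neighborSet, hC]; exact Or.inr ⟨j', rfl, hj'⟩, hp₂ j'⟩

omit [Fintype G] [Fintype G'] in
/-- The neighbourhood bijection at a check vertex: if `φ` maps `supp ã` bijectively onto `supp a` then
`j̃ ↦ φ j̃` maps `{j̃ : ã (ĩ − j̃) ≠ 0}` bijectively onto `{j : a (φ ĩ − j) ≠ 0}` (substitute `s̃ = ĩ − j̃`).
[cite: SymonsRajputBrowne2025, proof of Thm 3.1 / Lemma 3.2 (arXiv:2511.13560v3 chunk p0014 L15–31)] -/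
theorem bijOn_sub_of_bijOn_supp (φ : G' →+ G) {a' : G' → ZMod 2} {a : G → ZMod 2}
    (h : Set.BijOn φ {g | a' g ≠ 0} {g | a g ≠ 0}) (i : G') :
    Set.BijOn φ {j | a' (i - j) ≠ 0} {j | a (φ i - j) ≠ 0} := by
  refine ⟨fun j hj => ?_, fun j₁ hj₁ j₂ hj₂ hφ => ?_, fun j hj => ?_⟩
  · have := h.mapsTo hj
    simpa [map_sub] using this
  · have := h.injOn hj₁ hj₂ (by rw [map_sub, map_sub, hφ])
    exact sub_right_injective this
  · obtain ⟨s, hs, hφs⟩ := h.surjOn hj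
    refine ⟨i - s, by simpa using hs, ?_⟩
    rw [map_sub, hφs, sub_sub_cancel]

omit [Fintype G] [Fintype G'] in
/-- The same at a `Z`-check / for the transposed blocks: `{j̃ : ã (j̃ − ĩ) ≠ 0} → {j : a (j − φ ĩ) ≠ 0}`.
[cite: SymonsRajputBrowne2025, proof of Thm 3.1 / Lemma 3.2 (arXiv:2511.13560v3 chunk p0014 L15–31)] -/
theorem bijOn_sub'_of_bijOn_supp (φ : G' →+ G) {a' : G' → ZMod 2} {a : G → ZMod 2}
    (h : Set.BijOn φ {g | a' g ≠ 0} {g | a g ≠ 0}) (i : G') :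
    Set.BijOn φ {j | a' (j - i) ≠ 0} {j | a (j - φ i) ≠ 0} := by
  refine ⟨fun j hj => ?_, fun j₁ hj₁ j₂ hj₂ hφ => ?_, fun j hj => ?_⟩
  · have := h.mapsTo hj
    simpa [map_sub] using this
  · have := h.injOn hj₁ hj₂ (by rw [map_sub, map_sub, hφ])
    exact sub_left_injective this
  · obtain ⟨s, hs, hφs⟩ := h.surjOn hj
    refine ⟨s + i, by simpa using hs, ?_⟩
    rw [map_add, hφs, sub_add_cancel]

/-- **Theorem 3.3 (Symons–Rajput–Browne), abelian two-block form.** Under the algebraic cover condition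
the natural projection is a `|ker φ|`-sheeted covering map of Tanner graphs `T(css ã b̃) → T(css a b)`.
[cite: SymonsRajputBrowne2025, Thm 3.1 and Thm 3.3 (arXiv:2511.13560v3 chunk p0013 L23–40, p0016 L13–17: "the Tanner graph T̃ equipped with the natural projection map is a |Γ| = ut-fold covering graph of T")] -/
theorem isSheetedCovering_of_isAlgCover (φ : G' →+ G) (a' b' : G' → ZMod 2) (a b : G → ZMod 2)
    (h : IsAlgCover φ a' b' a b) :
    IsSheetedCovering (css a' b').tannerGraph (css a b).tannerGraph (coverMap φ) (Nat.card φ.ker) := by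
  obtain ⟨hφ, ha, hb⟩ := h
  refine ⟨⟨coverMap_surjective φ hφ, fun w => ?_⟩, card_fiber_coverMap φ hφ⟩
  have hXZ : ∀ j j' : G, vX j ≠ vZ j' := fun j j' h => by simp at h
  have hLR : ∀ j j' : G, vL j ≠ vR j' := fun j j' h => by simp at h
  rcases w with (i | i) | (j | j)
  · -- `X`-check `i`: neighbours `L j` (`ã (i − j) ≠ 0`) and `R j` (`b̃ (i − j) ≠ 0`)
    exact bijOn_two_families φ vL vR vL vR {j | a' (i - j) ≠ 0} {j | b' (i - j) ≠ 0}
      {j | a (φ i - j) ≠ 0} {j | b (φ i - j) ≠ 0} (adj_vX_iff a' b' i)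
      (fun y => by rw [show coverMap φ (Sum.inl (Sum.inl i)) = vX (φ i) from rfl, adj_vX_iff]; rfl)
      (fun j => rfl) (fun j => rfl) (fun x y h => by simpa using h) (fun x y h => by simpa using h) hLR
      (bijOn_sub_of_bijOn_supp φ ha i) (bijOn_sub_of_bijOn_supp φ hb i)
  · -- `Z`-check `i`: neighbours `L j` (`b̃ (j − i) ≠ 0`) and `R j` (`ã (j − i) ≠ 0`)
    exact bijOn_two_families φ vL vR vL vR {j | b' (j - i) ≠ 0} {j | a' (j - i) ≠ 0}
      {j | b (j - φ i) ≠ 0} {j | a (j - φ i) ≠ 0} (adj_vZ_iff a' b' i)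
      (fun y => by rw [show coverMap φ (Sum.inl (Sum.inr i)) = vZ (φ i) from rfl, adj_vZ_iff]; rfl)
      (fun j => rfl) (fun j => rfl) (fun x y h => by simpa using h) (fun x y h => by simpa using h) hLR
      (bijOn_sub'_of_bijOn_supp φ hb i) (bijOn_sub'_of_bijOn_supp φ ha i)
  · -- `L`-qubit `j`: neighbours `X i` (`ã (i − j) ≠ 0`) and `Z i` (`b̃ (j − i) ≠ 0`)
    exact bijOn_two_families φ vX vZ vX vZ {i | a' (i - j) ≠ 0} {i | b' (j - i) ≠ 0}
      {i | a (i - φ j) ≠ 0} {i | b (φ j - i) ≠ 0} (adj_vL_iff a' b' j)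
      (fun y => by rw [show coverMap φ (Sum.inr (Sum.inl j)) = vL (φ j) from rfl, adj_vL_iff]; rfl)
      (fun j => rfl) (fun j => rfl) (fun x y h => by simpa using h) (fun x y h => by simpa using h) hXZ
      (bijOn_sub'_of_bijOn_supp φ ha j) (bijOn_sub_of_bijOn_supp φ hb j)
  · -- `R`-qubit `j`: neighbours `X i` (`b̃ (i − j) ≠ 0`) and `Z i` (`ã (j − i) ≠ 0`)
    exact bijOn_two_families φ vX vZ vX vZ {i | b' (i - j) ≠ 0} {i | a' (j - i) ≠ 0}
      {i | b (i - φ j) ≠ 0} {i | a (φ j - i) ≠ 0} (adj_vR_iff a' b' j)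
      (fun y => by rw [show coverMap φ (Sum.inr (Sum.inr j)) = vR (φ j) from rfl, adj_vR_iff]; rfl)
      (fun j => rfl) (fun j => rfl) (fun x y h => by simpa using h) (fun x y h => by simpa using h) hXZ
      (bijOn_sub'_of_bijOn_supp φ hb j) (bijOn_sub_of_bijOn_supp φ ha j)

/-- **An algebraic cover is an `h`-cover code with `h = |ker φ|`** (SRB Thms 3.1 + 3.3 in the abelian
two-block vocabulary). [cite: SymonsRajputBrowne2025, Thm 3.3 (arXiv:2511.13560v3 chunk p0016 L13–17)] -/
theorem isTannerCover_of_isAlgCover (φ : G' →+ G) (a' b' : G' → ZMod 2) (a b : G → ZMod 2)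
    (h : IsAlgCover φ a' b' a b) : (css a' b').IsTannerCover (css a b) (Nat.card φ.ker) :=
  ⟨coverMap φ, isSheetedCovering_of_isAlgCover φ a' b' a b h⟩

end AbelianTwoBlock

end Literature.InformationTheory.QuantumCodes
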